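import Literature.Topology.FourManifolds.HomotopySpheresSumENR
import Literature.AlgebraicTopology.SingularHomology.HurewiczVanishingProofs
import HarnessLib

/-!
# Punctured homotopy spheres are contractible, from the Hurewicz theorem and the classification of surfaces

Topic `Literature/Topology/FourManifolds`, sibling proofs file of `HomotopySpheresInverse.lean` for
its named fact `Literature.Topology.FourManifolds.HomotopySphere.contractibleSpace_compl_singleton`
(for a homotopy `n`-sphere `Σ`, `n ≥ 2`, and any point `p`, `Σ ∖ {p}` is contractible — the
homotopy theory in Kervaire–Milnor, *Groups of homotopy spheres I* (1963), proof of Lemma 2.4,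
p. 507: "`W` contains `M - Interior i(½Dⁿ)` as deformation retract, and therefore is
contractible"). `HomotopySpheresSumProofs.lean` reduced the fact to the Whitehead–Hurewicz
recognition principle for manifolds (three leaves: Hurewicz, Whitehead — proved —, Milnor's CW
type of manifolds) for `n ≥ 3` and to the smooth Poincaré conjecture in dimension `2`; the ENR
route of `HomotopySpheresSumENR.lean` (compact retracts of open subsets of closed manifolds are
dominated by finite cube complexes, `CompactRetractContractible.lean`, and Whitehead's theorem
for CW-dominated spaces, `WhiteheadCWExtension.lean`) removed Milnor's theorem for the disc
complements `Σ ∖ i(B)`. This file draws the conclusion for the PUNCTURED manifold: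

* `HomotopySphere.contractibleSpace_compl_singleton_of_hurewicz_of_le`: for `n ≥ 3`, `Σ ∖ {p}`
  is contractible GIVEN only the vanishing form of the Hurewicz theorem
  (`Literature.AlgebraicTopology.SingularHomology.hurewicz_subsingleton`, Hatcher Thm. 4.32 at the zero group): it
  deformation retracts onto the complement of a small open chart disc around `p`
  (`BallComplement.homotopyEquiv`), contractible by the ENR argument
  (`HomotopySphere.contractibleSpace_compl_image_ball_of_isOpenEmbedding_of_hurewicz`, the
  topological-disc form of `…_of_hurewicz_of_le` of `HomotopySpheresSumENR.lean`).
* **The named fact, assembled**: `HomotopySphere.contractibleSpace_compl_singleton_of_hurewicz_of_two`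
  — `contractibleSpace_compl_singleton` from `hurewicz_subsingleton` (`n ≥ 3`) and the
  classification of closed surfaces in the form `nonemptyDiffeomorphSphere_two`
  (`SmoothPoincareLowDim.lean`; `n = 2`, with the stereographic projection); and the variants
  from `hurewicz_iso` / spc4.S32.
* `HomotopySphere.contractibleSpace_compl_singleton_of_homotopyAddition_of_le` / `…_of_two`: the
  same with `hurewicz_subsingleton` replaced by the homotopy addition theorem
  (`Literature.AlgebraicTopology.SingularHomology.homotopyAddition`, Spanier 1981 Prop. 7.5.3),
  from which the tree proves the Hurewicz vanishing theorem
  (`hurewicz_subsingleton_of_homotopyAddition`, `HurewiczVanishingProofs.lean`).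

After this file the trust base of `contractibleSpace_compl_singleton` is
{`homotopyAddition`, `nonemptyDiffeomorphSphere_two`}. Everything here is proved.

## References

* M. Kervaire, J. Milnor, *Groups of homotopy spheres I*, Ann. of Math. 77 (1963), proof of
  Lemma 2.4 (p. 507); p. 507 ("`Θ₂ = 0`"). [KervaireMilnorAnnals1963]
* A. Hatcher, *Algebraic Topology*, CUP (2002), Thm. 4.32; Appendix Cor. A.9, Prop. A.11.
  [HatcherAT2002]
* E. H. Spanier, *Algebraic Topology*, Springer (1981), Ch. 7 §5, Prop. 3, Thm. 5. [Spanier1981]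
-/

noncomputable section

open Set Function Metric Topology
open scoped Manifold ContDiff Topology ContinuousMap

namespace Literature.Topology.FourManifolds

namespace HomotopySphere

open Literature.AlgebraicTopology.Homotopy Literature.AlgebraicTopology.SingularHomology

variable {n : ℕ}

/-- **All homotopy groups of a punctured homotopy sphere vanish** (`n ≥ 3`), GIVEN the vanishing
form of the Hurewicz theorem (`hurewicz_subsingleton`, Hatcher 2002, Thm. 4.32): `Σ ∖ {p}` is
simply connected (general position, `PuncturedHomotopySphere.lean`) with `Hₖ(Σ ∖ {p}; ℤ) = 0`
for all `k ≥ 1` (Mayer–Vietoris, `PuncturedHomotopySphereHomology.lean`), so Hurewicz applies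
degree by degree. (Kosinski 1993, VI §2, Prop. 2.1: "simply connected and acyclic".)
[cite: HatcherAT2002, Thm. 4.32] [cite: Kosinski1993, Ch. VI §2 Prop. 2.1] -/
theorem subsingleton_homotopyGroup_compl_singleton_of_hurewicz (hH : hurewicz_subsingleton.{0})
    (hn : 3 ≤ n) (S : HomotopySphere n) (p : S.carrier) :
    ∀ k : ℕ, 1 ≤ k → ∀ x : ↥(({p}ᶜ : Set S.carrier)), Subsingleton (π_ k ↥(({p}ᶜ : Set S.carrier)) x) :=
  haveI : SimplyConnectedSpace ↥(({p}ᶜ : Set S.carrier)) := S.simplyConnectedSpace_compl_singleton hn p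
  subsingleton_homotopyGroup_of_isZero_singularHomology_of_subsingleton hH fun k hk =>
    S.isZero_singularHomology_compl_singleton (by omega) p hk

/-- **The complement of an open (not necessarily smooth) disc in a homotopy `n`-sphere, `n ≥ 3`,
is contractible, GIVEN Hurewicz** (vanishing form). For an open embedding `i : ℝⁿ → Σ`,
`K = Σ ∖ i(B)` is a compact retract of `U = Σ ∖ {i 0}` (radial retraction, `BallComplement.retr`),
homotopy equivalent to it (`BallComplement.homotopyEquiv`), so `K` is path connected with all
`π_k(K) = 0` (`subsingleton_homotopyGroup_compl_singleton_of_hurewicz`); being a compact retract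
of an open subset of the closed smooth manifold `Σ`, it is contractible
(`contractibleSpace_of_retract_of_compactSpace_manifold`). For smooth discs this is
`contractibleSpace_compl_image_ball_of_hurewicz_of_le` (`HomotopySpheresSumENR.lean`); the
topological form is what the punctured statement below consumes (a chart disc at `p`).
[cite: Kosinski1993, Ch. VI §1 (remark before Cor. 1.4)] [cite: HatcherAT2002, Thm. 4.32 and Prop. A.11] -/
theorem contractibleSpace_compl_image_ball_of_isOpenEmbedding_of_hurewicz
    (hH : hurewicz_subsingleton.{0}) (hn : 3 ≤ n) (S : HomotopySphere n)
    {i : EuclideanSpace ℝ (Fin n) → S.carrier} (hi : IsOpenEmbedding i) :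
    ContractibleSpace ↥((i '' ball (0 : EuclideanSpace ℝ (Fin n)) 1)ᶜ) := by
  set K : Set S.carrier := (i '' ball (0 : EuclideanSpace ℝ (Fin n)) 1)ᶜ with hK
  have hKU : K ⊆ ({i 0}ᶜ : Set S.carrier) := BallComplement.compl_image_ball_subset
  -- `K` is a retract of `U = Σ ∖ {i 0}`, hence path connected with vanishing homotopy groups
  have hU := subsingleton_homotopyGroup_compl_singleton_of_hurewicz hH hn S (i 0)
  haveI : PathConnectedSpace ↥(({i 0}ᶜ : Set S.carrier)) :=
    isPathConnected_iff_pathConnectedSpace.mp (S.isPathConnected_compl_singleton (by omega) (i 0))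
  have hsurj : Surjective (BallComplement.retr (X := S.carrier) hi) := fun x =>
    ⟨BallComplement.incl x, BallComplement.retrFun_incl hi.isEmbedding x⟩
  haveI : PathConnectedSpace ↥K := by
    rw [pathConnectedSpace_iff_univ, ← hsurj.range_eq]
    exact isPathConnected_range (BallComplement.retr (X := S.carrier) hi).continuous
  let y₀ : ↥K := Classical.arbitrary _
  have hπ : ∀ k : ℕ, 1 ≤ k → Subsingleton (π_ k ↥K y₀) := fun k hk =>
    subsingleton_homotopyGroup_of_homotopyEquiv (BallComplement.homotopyEquiv hi) (hU k hk) y₀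
  -- `K` is compact (closed in the compact `Σ`)
  have hKc : IsCompact K := (hi.isOpenMap _ isOpen_ball).isClosed_compl.isCompact
  exact contractibleSpace_of_retract_of_compactSpace_manifold (I := 𝓡 n) isOpen_compl_singleton
    hKc hKU (BallComplement.retr hi) (fun x hx => BallComplement.retrFun_incl hi.isEmbedding ⟨x, hx⟩)
    y₀ hπ

/-- **A punctured homotopy `n`-sphere, `n ≥ 3`, is contractible, GIVEN the Hurewicz theorem
(vanishing form) only**: `Σ ∖ {p}` deformation retracts onto the complement of a small open
chart disc around `p` (`BallComplement.homotopyEquiv`), which is contractible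
(`contractibleSpace_compl_image_ball_of_isOpenEmbedding_of_hurewicz`). This is the homotopy theory
in Kervaire–Milnor's Lemma 2.4 (1963, p. 507) in dimensions `n ≥ 3`, reduced to the Hurewicz
theorem alone. [cite: KervaireMilnorAnnals1963, Lemma 2.4, proof (p. 507)] [cite: HatcherAT2002, Thm. 4.32] -/
theorem contractibleSpace_compl_singleton_of_hurewicz_of_le (hH : hurewicz_subsingleton.{0})
    (hn : 3 ≤ n) (S : HomotopySphere n) (p : S.carrier) :
    ContractibleSpace ↥(({p}ᶜ : Set S.carrier)) := by
  obtain ⟨i, hi, rfl⟩ := exists_isOpenEmbedding_apply_zero_eq (E := EuclideanSpace ℝ (Fin n)) p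
  haveI := contractibleSpace_compl_image_ball_of_isOpenEmbedding_of_hurewicz hH hn S hi
  exact (BallComplement.homotopyEquiv hi).symm.contractibleSpace

/-! ### Assembly of the named fact -/

/-- **Punctured homotopy spheres are contractible (`n ≥ 2`), from the Hurewicz theorem and the
classification of surfaces.** The named fact `HomotopySphere.contractibleSpace_compl_singleton`
of `HomotopySpheresInverse.lean` (the homotopy theory in Kervaire–Milnor 1963, proof of
Lemma 2.4, p. 507) follows from (a) the vanishing form of the Hurewicz theorem
(`hurewicz_subsingleton`, Hatcher Thm. 4.32), used for `n ≥ 3`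
(`contractibleSpace_compl_singleton_of_hurewicz_of_le`), and (b) the smooth Poincaré conjecture
in dimension `2` — the classification of closed surfaces — in the form of the named fact
`nonemptyDiffeomorphSphere_two` (`SmoothPoincareLowDim.lean`; Kervaire–Milnor p. 507,
"`Θ₂ = 0`"), used for `n = 2` with the stereographic projection
(`contractibleSpace_compl_singleton_of_nonemptyDiffeomorphSphere`); everything else is proved.
[cite: KervaireMilnorAnnals1963, Lemma 2.4, proof (p. 507)] -/
theorem contractibleSpace_compl_singleton_of_hurewicz_of_two (hH : hurewicz_subsingleton.{0})
    (h2 : nonemptyDiffeomorphSphere_two.{0}) : HomotopySphere.contractibleSpace_compl_singleton := by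
  intro n S p hn
  change ContractibleSpace ↥(({p}ᶜ : Set S.carrier))
  rcases (show n = 2 ∨ 3 ≤ n by omega) with rfl | h3
  · exact contractibleSpace_compl_singleton_of_nonemptyDiffeomorphSphere (fun M _ _ _ => h2 M) S p
  · exact contractibleSpace_compl_singleton_of_hurewicz_of_le hH h3 S p

/-- The same from the isomorphism clause `hurewicz_iso` (Hatcher Thm. 4.32 as printed).
[cite: KervaireMilnorAnnals1963, Lemma 2.4, proof (p. 507)] -/
theorem contractibleSpace_compl_singleton_of_hurewiczIso_of_two (h : hurewicz_iso.{0})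
    (h2 : nonemptyDiffeomorphSphere_two.{0}) : HomotopySphere.contractibleSpace_compl_singleton :=
  contractibleSpace_compl_singleton_of_hurewicz_of_two (hurewicz_subsingleton_of_iso h) h2

/-- The same with the dimension-`2` input taken from spc4.S32 (`nonemptyDiffeomorphSphere_of_mem`).
[cite: KervaireMilnorAnnals1963, Lemma 2.4, proof (p. 507)] -/
theorem contractibleSpace_compl_singleton_of_hurewicz_of_facts (hH : hurewicz_subsingleton.{0})
    (h32 : FourManifolds.nonemptyDiffeomorphSphere_of_mem.{0}) :
    HomotopySphere.contractibleSpace_compl_singleton :=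
  contractibleSpace_compl_singleton_of_hurewicz_of_two hH (nonemptyDiffeomorphSphere_two_of_mem h32)

/-- **Punctured homotopy spheres are contractible, `n ≥ 3`, given the homotopy addition theorem
alone**: the tree now proves the Hurewicz vanishing theorem from the homotopy addition theorem
(`Literature.AlgebraicTopology.SingularHomology.hurewicz_subsingleton_of_homotopyAddition`,
`HurewiczVanishingProofs.lean`; Spanier 1981, Ch. 7 §5 Thm. 5 from Prop. 3), so for `n ≥ 3` the
only remaining input of Kervaire–Milnor's contractibility of `Σ ∖ {p}` (1963, proof of Lemma 2.4,
p. 507) is the named fact `homotopyAddition` (Spanier Prop. 7.5.3).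
[cite: KervaireMilnorAnnals1963, Lemma 2.4, proof (p. 507)] [cite: Spanier1981, Ch. 7 §5 Prop. 3] -/
theorem contractibleSpace_compl_singleton_of_homotopyAddition_of_le
    (hA : Literature.AlgebraicTopology.SingularHomology.homotopyAddition.{0}) {n : ℕ} (hn : 3 ≤ n)
    (S : HomotopySphere n) (p : S.carrier) : ContractibleSpace ↥({p}ᶜ : Set S.carrier) :=
  contractibleSpace_compl_singleton_of_hurewicz_of_le
    (Literature.AlgebraicTopology.SingularHomology.hurewicz_subsingleton_of_homotopyAddition hA) hn S p

/-- **`HomotopySphere.contractibleSpace_compl_singleton` from the homotopy addition theorem and the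
smooth Poincaré conjecture in dimension two** — the current trust base of the fact: `n ≥ 3` from
`homotopyAddition` (through the Hurewicz vanishing theorem, proved in the tree), `n = 2` from
`nonemptyDiffeomorphSphere_two` (classification of surfaces). The discharge
`contractibleSpace_compl_singleton_holds` is this theorem applied to the two `_holds` once they
land. [cite: KervaireMilnorAnnals1963, Lemma 2.4, proof (p. 507)] [cite: Spanier1981, Ch. 7 §5 Prop. 3] -/
theorem contractibleSpace_compl_singleton_of_homotopyAddition_of_two
    (hA : Literature.AlgebraicTopology.SingularHomology.homotopyAddition.{0})
    (h2 : nonemptyDiffeomorphSphere_two.{0}) : HomotopySphere.contractibleSpace_compl_singleton :=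
  contractibleSpace_compl_singleton_of_hurewicz_of_two
    (Literature.AlgebraicTopology.SingularHomology.hurewicz_subsingleton_of_homotopyAddition hA) h2

end HomotopySphere

end Literature.Topology.FourManifolds

end
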